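import Mathlib
import Summits.ValiantsHypothesis.ValiantsHypothesis.Theorems.LacunarySymmetroidMatrixDescartesDefiniteMomentsKit

/-!
# `MatrixDescartes` (stmt-ValiantsHypothesis-18050) — the DEFINITE-MOMENTS LAW, zones I: the sign law of a
# Descartes-sharp real polynomial (scalar kit for the lacunary Markus theorem)

HONEST FRAMING.  Cell `pub-symmetroid`, seat `val-sym-mdr-p2` (gen 15); helper file `--supports` the crux
`Theses.LacunarySymmetroid.MatrixDescartes`, NO closure claim.  Scalar lemmas only (one real polynomial); nothing here
bears on the crux in its window, on `stub_twoSided`, on `DoorA26`/`DoorA34`, registers, or `VP ≠ VNP`.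

CONTENT (kit for `…DefiniteMomentsZonesLocal/Planar/…Zones`: the LACUNARY MARKUS THEOREM «Rayleigh-sharp ⇒ separated
spectral zones ⇒ K alternating definite scales»).  For a real polynomial `P ≠ 0` whose positive roots are SHARP — no more
positive roots with multiplicity than distinct positive roots, which is what Descartes' bound forces on a `K`-nomial with
`K − 1` distinct positive zeros —
* `rootMultiplicity_le_one_of_sharp`: every positive root is simple;
* `eval_mul_eval_neg_of_simpleRoot`: across an isolated simple root the sign FLIPS (`P(a)·P(b) < 0`);
* `mul_pos_of_noZero`: no zero on `[a, b]` ⇒ one sign (`f(a)·f(b) > 0`);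
* `sharp_sign_law`: if `P` has the sign `s` near `0⁺`, then at every positive non-root `x`
  `0 < s·(−1)^{N(x)}·P(x)`, `N(x)` = the number of roots of `P` in `(0, x)` — the PARITY LAW used by the planar loop argument.
[folklore]; axioms `propext`, `Classical.choice`, `Quot.sound`; no definitions.
-/

-- layout Summits/ValiantsHypothesis/ValiantsHypothesis forces the duplicated namespace component
set_option linter.dupNamespace false

namespace Summit.ValiantsHypothesis.ValiantsHypothesis.Theorems.LacunarySymmetroidMatrixDescartes

open Polynomial Finset
open scoped BigOperators

namespace DefiniteMoments

/-! ## §1 One sign on a zero-free interval -/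

/-- A continuous function without zeros on `[a, b]` (`a ≤ b`) has values of the same strict sign at the two ends.
[folklore] -/
theorem mul_pos_of_noZero {f : ℝ → ℝ} (hf : Continuous f) {a b : ℝ} (hab : a ≤ b)
    (hno : ∀ z : ℝ, a ≤ z → z ≤ b → f z ≠ 0) : 0 < f a * f b := by
  rcases hab.lt_or_eq with hlt | heq
  · by_contra h
    push Not at h
    rcases h.lt_or_eq with hneg | hzero
    · obtain ⟨z, hz1, hz2, hz3⟩ := exists_zero_of_mul_neg hf hlt hneg
      exact hno z hz1.le hz2.le hz3
    · rcases mul_eq_zero.1 hzero with h0 | h0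
      · exact hno a le_rfl hlt.le h0
      · exact hno b hlt.le le_rfl h0
  · subst heq
    exact mul_self_pos.2 (hno a le_rfl le_rfl)

/-! ## §2 Sharp positive roots are simple -/

/-- **Sharpness ⇒ simple positive roots.**  If `P` has no more positive roots counted with multiplicity than distinct
positive roots, then every positive real has root multiplicity at most one. [folklore] -/
theorem rootMultiplicity_le_one_of_sharp (P : ℝ[X])
    (hsharp : (P.roots.filter (fun t => 0 < t)).card ≤ (P.roots.toFinset.filter (fun t => 0 < t)).card)
    {r : ℝ} (hr : 0 < r) : P.rootMultiplicity r ≤ 1 := by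
  classical
  set M := P.roots.filter (fun t => 0 < t) with hM
  have hcard : (P.roots.toFinset.filter (fun t => 0 < t)).card = M.dedup.card := by
    rw [← Multiset.toFinset_filter, Finset.card_def, Multiset.toFinset_val]
  have hdedup : M.dedup = M :=
    Multiset.eq_of_le_of_card_le (Multiset.dedup_le M) (by rw [← hcard]; exact hsharp)
  have hnd : M.Nodup := by rw [← hdedup]; exact Multiset.nodup_dedup M
  have h1 : M.count r ≤ 1 := Multiset.nodup_iff_count_le_one.1 hnd r
  rw [hM, Multiset.count_filter_of_pos hr, Polynomial.count_roots] at h1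
  exact h1

/-! ## §3 The sign flips across an isolated simple root -/

/-- **Flip lemma.**  `P ≠ 0`, `r` a root of multiplicity at most one, `a < r < b`, and `r` the only root of `P` in
`[a, b]`: then `P(a)·P(b) < 0`.  (`P = (X − r)·Q` with `Q(r) ≠ 0`, `Q` zero-free on `[a, b]`.) [folklore] -/
theorem eval_mul_eval_neg_of_simpleRoot (P : ℝ[X]) (hP : P ≠ 0) {a r b : ℝ} (har : a < r) (hrb : r < b)
    (hroot : P.IsRoot r) (hmult : P.rootMultiplicity r ≤ 1)
    (hno : ∀ z : ℝ, a ≤ z → z ≤ b → P.IsRoot z → z = r) : P.eval a * P.eval b < 0 := by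
  set Q := P /ₘ (X - C r) with hQ
  have hPQ : (X - C r) * Q = P := mul_divByMonic_eq_iff_isRoot.2 hroot
  have hQr : Q.eval r ≠ 0 := by
    intro h0
    have hdvd : (X - C r) ^ 2 ∣ P := by
      obtain ⟨R, hR⟩ := dvd_iff_isRoot.2 h0
      refine ⟨R, ?_⟩
      rw [← hPQ, hR]; ring
    have h2 := (le_rootMultiplicity_iff hP).2 hdvd
    omega
  have hQno : ∀ z : ℝ, a ≤ z → z ≤ b → Q.eval z ≠ 0 := by
    intro z hz1 hz2 hQz
    have hPz : P.IsRoot z := by rw [IsRoot, ← hPQ, eval_mul, hQz, mul_zero]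
    have hzr := hno z hz1 hz2 hPz
    rw [hzr] at hQz
    exact hQr hQz
  have hQab : 0 < Q.eval a * Q.eval b := mul_pos_of_noZero Q.continuous (har.trans hrb).le hQno
  have hPa : P.eval a = (a - r) * Q.eval a := by rw [← hPQ, eval_mul, eval_sub, eval_X, eval_C]
  have hPb : P.eval b = (b - r) * Q.eval b := by rw [← hPQ, eval_mul, eval_sub, eval_X, eval_C]
  have hneg : (a - r) * (b - r) < 0 := mul_neg_of_neg_of_pos (by linarith) (by linarith)
  rw [hPa, hPb]
  have e : (a - r) * Q.eval a * ((b - r) * Q.eval b) = ((a - r) * (b - r)) * (Q.eval a * Q.eval b) := by ring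
  rw [e]
  exact mul_neg_of_neg_of_pos hneg hQab

/-! ## §4 The sign law of a sharp polynomial -/

/-- Membership in the finset of roots of `P ≠ 0` lying in `(0, x)`. [folklore] -/
theorem mem_rootsBelow (P : ℝ[X]) (hP : P ≠ 0) (x t : ℝ) :
    t ∈ P.roots.toFinset.filter (fun t => 0 < t ∧ t < x) ↔ P.IsRoot t ∧ 0 < t ∧ t < x := by
  rw [Finset.mem_filter, Multiset.mem_toFinset, mem_roots hP]

/-- Monotonicity of the count of roots below `x`. [folklore] -/
theorem card_rootsBelow_mono (P : ℝ[X]) {x y : ℝ} (hxy : x ≤ y) :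
    (P.roots.toFinset.filter (fun t => 0 < t ∧ t < x)).card
      ≤ (P.roots.toFinset.filter (fun t => 0 < t ∧ t < y)).card :=
  Finset.card_le_card (Finset.monotone_filter_right _ fun _ _ ht => ⟨ht.1, ht.2.trans_le hxy⟩)

/-- If `P` has no root in `[x, y)` then the counts of roots below `x` and below `y` agree. [folklore] -/
theorem card_rootsBelow_eq_of_noRoot (P : ℝ[X]) (hP : P ≠ 0) {x y : ℝ} (hxy : x ≤ y)
    (hno : ∀ z : ℝ, x ≤ z → z < y → ¬ P.IsRoot z) :
    (P.roots.toFinset.filter (fun t => 0 < t ∧ t < x)).card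
      = (P.roots.toFinset.filter (fun t => 0 < t ∧ t < y)).card := by
  congr 1
  ext t
  rw [mem_rootsBelow P hP, mem_rootsBelow P hP]
  constructor
  · rintro ⟨h1, h2, h3⟩; exact ⟨h1, h2, h3.trans_le hxy⟩
  · rintro ⟨h1, h2, h3⟩
    refine ⟨h1, h2, ?_⟩
    by_contra hle
    push Not at hle
    exact hno t hle h3 h1

/-- **THE SIGN LAW OF A SHARP POLYNOMIAL (parity law).**  `P ≠ 0` with sharp positive roots (no more positive roots with
multiplicity than distinct ones) and of sign `s` on some interval `(0, δ)`.  Then at every positive `x` with `P(x) ≠ 0`,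
`0 < s·(−1)^{N(x)}·P(x)`, where `N(x)` is the number of roots of `P` in `(0, x)`: the sign is constant between consecutive
roots (`mul_pos_of_noZero`) and flips at each of them (`eval_mul_eval_neg_of_simpleRoot`). [folklore] -/
theorem sharp_sign_law (P : ℝ[X]) (hP : P ≠ 0)
    (hsharp : (P.roots.filter (fun t => 0 < t)).card ≤ (P.roots.toFinset.filter (fun t => 0 < t)).card)
    (s : ℝ) (hs : ∃ δ : ℝ, 0 < δ ∧ ∀ x : ℝ, 0 < x → x < δ → 0 < s * P.eval x) :
    ∀ x : ℝ, 0 < x → ¬ P.IsRoot x →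
      0 < s * (-1) ^ (P.roots.toFinset.filter (fun t => 0 < t ∧ t < x)).card * P.eval x := by
  classical
  obtain ⟨δ, hδ, hsδ⟩ := hs
  -- induction on the number of roots below `x`
  suffices key : ∀ (n : ℕ) (x : ℝ), (P.roots.toFinset.filter (fun t => 0 < t ∧ t < x)).card = n → 0 < x →
      ¬ P.IsRoot x → 0 < s * (-1) ^ n * P.eval x from
    fun x hx hnot => key _ x rfl hx hnot
  intro n
  induction n with
  | zero =>
    intro x hcard hx hnot
    rw [pow_zero, mul_one]
    by_cases hxδ : x < δ
    · exact hsδ x hx hxδ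
    · push Not at hxδ
      -- no root in `[δ/2, x]`: same sign at `δ/2` and at `x`
      have hno : ∀ z : ℝ, δ / 2 ≤ z → z ≤ x → P.eval z ≠ 0 := by
        intro z hz1 hz2 hPz
        rcases hz2.lt_or_eq with hlt | heq
        · have hmem : z ∈ P.roots.toFinset.filter (fun t => 0 < t ∧ t < x) :=
            (mem_rootsBelow P hP x z).2 ⟨hPz, by linarith, hlt⟩
          rw [Finset.card_eq_zero] at hcard
          rw [hcard] at hmem
          exact Finset.notMem_empty z hmem
        · rw [heq] at hPz; exact hnot hPz
      have h2 := mul_pos_of_noZero P.continuous (by linarith) hno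
      have h1 := hsδ (δ / 2) (by linarith) (by linarith)
      have ha : P.eval (δ / 2) ≠ 0 := hno (δ / 2) le_rfl (by linarith)
      have h3 : 0 < (s * P.eval x) * (P.eval (δ / 2) * P.eval (δ / 2)) := by nlinarith
      exact (mul_pos_iff_of_pos_right (mul_self_pos.2 ha)).1 h3
  | succ n ih =>
    intro x hcard hx hnot
    set B := P.roots.toFinset.filter (fun t => 0 < t ∧ t < x) with hB
    have hBne : B.Nonempty := by rw [← Finset.card_pos, hcard]; exact Nat.succ_pos n
    set r := B.max' hBne with hr
    have hrmem : r ∈ B := B.max'_mem hBne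
    obtain ⟨hrroot, hr0, hrx⟩ := (mem_rootsBelow P hP x r).1 hrmem
    have hrmax : ∀ t ∈ B, t ≤ r := fun t ht => B.le_max' t ht
    -- no root in `(r, x]`
    have hno_right : ∀ z : ℝ, r < z → z ≤ x → ¬ P.IsRoot z := by
      intro z hz1 hz2 hPz
      rcases hz2.lt_or_eq with hlt | heq
      · have := hrmax z ((mem_rootsBelow P hP x z).2 ⟨hPz, hr0.trans hz1, hlt⟩)
        linarith
      · rw [heq] at hPz; exact hnot hPz
    -- the roots below `r`
    set L := P.roots.toFinset.filter (fun t => 0 < t ∧ t < r) with hL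
    have hLB : L = B.erase r := by
      ext t
      rw [Finset.mem_erase, hL, mem_rootsBelow P hP r t, hB, mem_rootsBelow P hP x t]
      constructor
      · rintro ⟨h1, h2, h3⟩; exact ⟨ne_of_lt h3, h1, h2, h3.trans hrx⟩
      · rintro ⟨hne, h1, h2, h3⟩
        exact ⟨h1, h2, lt_of_le_of_ne (hrmax t ((mem_rootsBelow P hP x t).2 ⟨h1, h2, h3⟩)) hne⟩
    have hLcard : L.card = n := by
      rw [hLB, Finset.card_erase_of_mem hrmem, hcard]; rfl
    -- a test point `a` in `(0, r)` above all roots below `r`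
    obtain ⟨a, ha0, har, hano⟩ : ∃ a : ℝ, 0 < a ∧ a < r ∧ ∀ z : ℝ, a ≤ z → z < r → ¬ P.IsRoot z := by
      by_cases hLe : L.Nonempty
      · set r' := L.max' hLe with hr'
        obtain ⟨-, hr'0, hr'r⟩ := (mem_rootsBelow P hP r r').1 (L.max'_mem hLe)
        refine ⟨(r' + r) / 2, by linarith, by linarith, fun z hz1 hz2 hPz => ?_⟩
        have := L.le_max' z ((mem_rootsBelow P hP r z).2 ⟨hPz, by linarith, hz2⟩)
        rw [← hr'] at this
        linarith
      · refine ⟨r / 2, by linarith, by linarith, fun z hz1 hz2 hPz => ?_⟩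
        exact hLe ⟨z, (mem_rootsBelow P hP r z).2 ⟨hPz, by linarith, hz2⟩⟩
    have hanot : ¬ P.IsRoot a := hano a le_rfl har
    -- induction hypothesis at `a`
    have hcarda : (P.roots.toFinset.filter (fun t => 0 < t ∧ t < a)).card = n := by
      rw [card_rootsBelow_eq_of_noRoot P hP har.le hano, ← hL, hLcard]
    have hsa := ih a hcarda ha0 hanot
    -- the flip across `r` on `[a, x]`
    have hflip : P.eval a * P.eval x < 0 := by
      refine eval_mul_eval_neg_of_simpleRoot P hP har hrx hrroot
        (rootMultiplicity_le_one_of_sharp P hsharp hr0) fun z hz1 hz2 hPz => ?_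
      by_contra hne
      rcases lt_or_gt_of_ne hne with hlt | hgt
      · exact hano z hz1 hlt hPz
      · exact hno_right z hgt hz2 hPz
    rw [pow_succ]
    have e : s * ((-1) ^ n * -1) * P.eval x = -(s * (-1) ^ n * P.eval x) := by ring
    rw [e]
    have hPa : P.eval a ≠ 0 := hanot
    nlinarith [mul_pos hsa (neg_pos.2 hflip), mul_self_pos.2 hPa]

/-- **Sign law, product form.**  Under the hypotheses of `sharp_sign_law`, two positive non-roots `x ≤ y` carry the same
sign iff an even number of roots lies in `[x, y)`: `0 < (−1)^{N(y) − N(x)}·P(x)·P(y)` written multiplicatively. [folklore] -/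
theorem sharp_sign_law_pair (P : ℝ[X]) (hP : P ≠ 0)
    (hsharp : (P.roots.filter (fun t => 0 < t)).card ≤ (P.roots.toFinset.filter (fun t => 0 < t)).card)
    (s : ℝ) (hs : ∃ δ : ℝ, 0 < δ ∧ ∀ x : ℝ, 0 < x → x < δ → 0 < s * P.eval x)
    {x y : ℝ} (hx : 0 < x) (hy : 0 < y) (hxr : ¬ P.IsRoot x) (hyr : ¬ P.IsRoot y) :
    0 < (-1) ^ ((P.roots.toFinset.filter (fun t => 0 < t ∧ t < x)).card
          + (P.roots.toFinset.filter (fun t => 0 < t ∧ t < y)).card) * (P.eval x * P.eval y) := by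
  have h1 := sharp_sign_law P hP hsharp s hs x hx hxr
  have h2 := sharp_sign_law P hP hsharp s hs y hy hyr
  have h3 := mul_pos h1 h2
  have hs0 : s ≠ 0 := by rintro rfl; simp at h1
  have e : s * (-1) ^ (P.roots.toFinset.filter (fun t => 0 < t ∧ t < x)).card * P.eval x
      * (s * (-1) ^ (P.roots.toFinset.filter (fun t => 0 < t ∧ t < y)).card * P.eval y)
      = (s * s) * ((-1) ^ ((P.roots.toFinset.filter (fun t => 0 < t ∧ t < x)).card
          + (P.roots.toFinset.filter (fun t => 0 < t ∧ t < y)).card) * (P.eval x * P.eval y)) := by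
    rw [pow_add]; ring
  rw [e] at h3
  exact (mul_pos_iff_of_pos_left (mul_self_pos.2 hs0)).1 h3

end DefiniteMoments

end Summit.ValiantsHypothesis.ValiantsHypothesis.Theorems.LacunarySymmetroidMatrixDescartes
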